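/-
Origin: expansion seat `planner-pub-hodgecm-pv06-g7-0`, handover #5 (CLAIM 2026-08-18T15:30:30Z; HANDOVER #5 2026-08-18T15:41:08Z) md5 04968ee0b8d7f940fadfd382aa3998ed (205 l.); additive KERNEL leaf (node N29 / seam S4: hermiteSchwartz p : Schwartz(EuclideanSpace R iota, C) = pv05 hermiteFun packaged via SchwartzMap.smulLeftCLM (polyE p) (SchwartzWeil.gaussian), hasTemperateGrowth_polyE, gauss_eq_gaussian; hypVelE / hypRotE on E6 with hypVelE_mul_self (J*J=1) a (`HOME/pub-hodgecm-pv06-g7/lean/Pv06g7/ArchCHyperbolicSchwartz.lean`, md5 04968ee0, 205 lines);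
landed by the gen-8 packager in gate run 31 as `HodgeCM/PerL34/ArchCHyperbolicSchwartz.lean` (import ^import Pv06g7\.ArchCHyperbolicFDeriv[ \t]*$→import HodgeCM.PerL34.ArchCHyperbolicFDeriv ×1).
-/
/-
Copyright (c) 2026. Released under the Apache-2.0 license.
-/
import Summits.HodgeConjecture.HodgeCM.PerL34.ArchCHyperbolicFDeriv
import Summits.HodgeConjecture.HodgeCM.Automorphic.SchwartzGaussian_2

/-!
# The Hermite-span functions as Schwartz functions on `ℝ³ × ℝ³` and the hyperbolic flow generator (node N29, seam S4)

Origin: expansion seat `planner-pub-hodgecm-pv06-g7-0` (unit `pub-hodgecm-pv06-g7`, DAG-node prover #06 gen 7).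
WIP module `Pv06g7.ArchCHyperbolicSchwartz`; intended final place `HodgeCM/PerL34/ArchCHyperbolicSchwartz.lean`.
Imports: this seat's row #4 `Pv06g7.ArchCHyperbolicFDeriv` (↦ `HodgeCM.PerL34.ArchCHyperbolicFDeriv`, ONE rewrite)
and the TREE module `HodgeCM.Automorphic.SchwartzGaussian` (pv07 lineage: `SchwartzWeil.gaussian V : 𝓢(V, ℂ)`).
Additive kernel leaf: asserts nothing, complete proofs, nothing cited enters as a hypothesis.

## What is proved (KERNEL)

Rows #2–#4 computed the derivative of pv05's Hermite-span functions `hermiteFun p = p(x) e^{−π|x|²}` along the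
hyperbolic rotation `hypRot s` as plain functions on `MixedVar → ℝ`.  The `smooth` clause of the S4 records and
pv14-g6's flow calculus (`SchwartzLinearFlowDeriv`, `SchwartzHyperbolicFlow`: `flowGen A Φ x = DΦ(x)(Ax)`,
`involFlow J`, run 31) live on SCHWARTZ SPACE `𝓢(E, ℂ)` of a real normed space `E`.  This file does the packaging:

* §1 (generic finite index type `ι`, `E = EuclideanSpace ℝ ι`) `polyE p` (the polynomial factor, of temperate
  growth: `hasTemperateGrowth_polyE`), **`hermiteSchwartz p : 𝓢(EuclideanSpace ℝ ι, ℂ)`**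
  `:= SchwartzMap.smulLeftCLM ℂ (polyE p) (SchwartzWeil.gaussian _)` with
  **`hermiteSchwartz_apply : hermiteSchwartz p x = hermiteFun p ⇑x`** (`gauss_eq_gaussian`: pv05's `gauss` IS
  pv07's `gaussian` on Euclidean space), linear in `p` (`hermiteSchwartz_add/_smul`).
* §2 (`ι = MixedVar`, `E6 = EuclideanSpace ℝ MixedVar ≅ ℝ³ × ℝ³`) the velocity and the flow transported along
  `EuclideanSpace.equiv`: `hypVelE : E6 →L[ℝ] E6` with **`hypVelE_mul_self : hypVelE * hypVelE = 1`** (the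
  hypothesis `hJ` of pv14-g6's `involFlow`), `hypRotE s : E6 ≃L[ℝ] E6` with
  `hypRotE_eq_cosh_add_sinh : ↑(hypRotE s) = cosh s • 1 + sinh s • hypVelE` (= pv14-g6's `coshSinhCLM hypVelE s`).
* §3 **`fderiv_hermiteSchwartz_hypVelE : fderiv ℝ ⇑(hermiteSchwartz p) x (hypVelE x) = hermiteSchwartz (hypSymb p) x`**
  — i.e. pv14-g6's `flowGen hypVelE (hermiteSchwartz p) = hermiteSchwartz (hypSymb p)` as Schwartz functions
  (their `flowGen_apply` is `rfl`), and through pv05's Bargmann dictionary (row #2 `binv_printedHyp`)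
  **`fderiv_hermiteSchwartz_binv_hypVelE : … = hermiteSchwartz (binv (printedHyp lamF F)) x`**: on the Schwartz
  functions `hermiteSchwartz (binv F)`, `F ∈ ℂ[z_a, w_a]` (the Schrödinger images of the Fock polynomials), the
  𝒮-generator of the hyperbolic-rotation flow is pv12's printed Fock operator of `X₁ = E₀₁ + E₁₀` at Folland's
  scaling.  With pv14-g6 #25 (`tendsto_compCLM_involFlow_sub_div_ofReal`) this is the Σ₁₂ analytic clause of
  `HypSmoothSide.smooth` for the composition flow `Φ ↦ Φ ∘ involFlow hypVelE s`, for every Schwartz `Φ`.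

Labels.  KERNEL: everything below.  Not done here (honest): the model identification of the CONSTRUCTED `ω(exp sX₁)`
with `Φ ↦ Φ ∘ hypRotE (±s)` ([SETUP D4], pv11-g9 ENDSTATE-S4-SPEC §3).  PerL / QW8 / 2001 texts NOT cited.
-/

set_option autoImplicit false

noncomputable section

namespace HodgeCM
namespace PerL34
namespace Fock
namespace PrintDict

open MvPolynomial Complex SchwartzMap
open scoped BigOperators Real
open HodgeCM.PerL34.Fock.Hermite HodgeCM.SchwartzWeil

/-! ## §1  `p e^{−π|·|²}` as a Schwartz function on Euclidean space -/

section Generic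

variable {ι : Type*} [Fintype ι]

/-- The polynomial factor `x ↦ p(x)` on Euclidean space. -/
def polyE (p : MvPolynomial ι ℂ) (x : EuclideanSpace ℝ ι) : ℂ := eval (fun k => ((x k : ℝ) : ℂ)) p

omit [Fintype ι] in
/-- (Ported verbatim from the HodgeCMPerL package; no docstring in the source.) -/
theorem polyE_apply (p : MvPolynomial ι ℂ) (x : EuclideanSpace ℝ ι) :
    polyE p x = eval (fun k => ((x k : ℝ) : ℂ)) p := rfl

/-- A real coordinate of Euclidean space, as a complex number, is a continuous linear map, hence temperate. -/
theorem hasTemperateGrowth_coordE (k : ι) :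
    (fun x : EuclideanSpace ℝ ι => ((x k : ℝ) : ℂ)).HasTemperateGrowth :=
  (Complex.ofRealCLM.comp ((ContinuousLinearMap.proj k).comp
    (EuclideanSpace.equiv ι ℝ : EuclideanSpace ℝ ι →L[ℝ] (ι → ℝ)))).hasTemperateGrowth

/-- Polynomials have temperate growth (induction on the polynomial; Mathlib's `HasTemperateGrowth.add/.mul`). -/
theorem hasTemperateGrowth_polyE (p : MvPolynomial ι ℂ) : (polyE p).HasTemperateGrowth := by
  induction p using MvPolynomial.induction_on with
  | C a =>
      have h : (polyE (C a : MvPolynomial ι ℂ)) = fun _ => a := by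
        funext x; simp [polyE]
      rw [h]; exact Function.HasTemperateGrowth.const a
  | add p q hp hq =>
      have h : polyE (p + q) = polyE p + polyE q := by
        funext x; simp [polyE]
      rw [h]; exact hp.add hq
  | mul_X p k hp =>
      have h : polyE (p * X k) = polyE p * fun x : EuclideanSpace ℝ ι => ((x k : ℝ) : ℂ) := by
        funext x; simp [polyE]
      rw [h]; exact hp.mul (hasTemperateGrowth_coordE k)

/-- pv05's Gaussian `gauss` on `ι → ℝ` IS pv07's Schwartz Gaussian on Euclidean space. -/
theorem gauss_eq_gaussian (x : EuclideanSpace ℝ ι) : gauss (⇑x : ι → ℝ) = gaussian (EuclideanSpace ℝ ι) x := by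
  rw [gaussian_apply, gauss]
  congr 1
  rw [← Complex.ofReal_pow, EuclideanSpace.real_norm_sq_eq]
  push_cast
  ring

/-- **`p e^{−π|·|²}` as a Schwartz function** on `EuclideanSpace ℝ ι` (KERNEL). -/
def hermiteSchwartz (p : MvPolynomial ι ℂ) : 𝓢(EuclideanSpace ℝ ι, ℂ) :=
  SchwartzMap.smulLeftCLM ℂ (polyE p) (gaussian (EuclideanSpace ℝ ι))

/-- Its values: `hermiteSchwartz p x = hermiteFun p x` (pv05's function, evaluated at the coordinates of `x`). -/
theorem hermiteSchwartz_apply (p : MvPolynomial ι ℂ) (x : EuclideanSpace ℝ ι) :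
    hermiteSchwartz p x = hermiteFun p (⇑x : ι → ℝ) := by
  rw [hermiteSchwartz, SchwartzMap.smulLeftCLM_apply_apply (hasTemperateGrowth_polyE p), smul_eq_mul,
    hermiteFun, gauss_eq_gaussian, polyE]

/-- The same through `EuclideanSpace.equiv` (which is the coordinate map). -/
theorem hermiteSchwartz_apply' (p : MvPolynomial ι ℂ) (x : EuclideanSpace ℝ ι) :
    hermiteSchwartz p x = hermiteFun p (EuclideanSpace.equiv ι ℝ x) :=
  hermiteSchwartz_apply p x

/-- (Ported verbatim from the HodgeCMPerL package; no docstring in the source.) -/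
theorem coe_hermiteSchwartz (p : MvPolynomial ι ℂ) :
    ⇑(hermiteSchwartz p) = fun x : EuclideanSpace ℝ ι => hermiteFun p (EuclideanSpace.equiv ι ℝ x) :=
  funext (hermiteSchwartz_apply p)

/-- (Ported verbatim from the HodgeCMPerL package; no docstring in the source.) -/
theorem hermiteSchwartz_add (p q : MvPolynomial ι ℂ) :
    hermiteSchwartz (p + q) = hermiteSchwartz p + hermiteSchwartz q := by
  ext x
  simp [hermiteSchwartz_apply, hermiteFun_add]

/-- (Ported verbatim from the HodgeCMPerL package; no docstring in the source.) -/
theorem hermiteSchwartz_smul (c : ℂ) (p : MvPolynomial ι ℂ) :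
    hermiteSchwartz (c • p) = c • hermiteSchwartz p := by
  ext x
  simp [hermiteSchwartz_apply, hermiteFun_smul]

/-- The packaging as a `ℂ`-linear map `ℂ[x_ι] →ₗ 𝓢(EuclideanSpace ℝ ι, ℂ)`. -/
def hermiteSchwartzₗ : MvPolynomial ι ℂ →ₗ[ℂ] 𝓢(EuclideanSpace ℝ ι, ℂ) where
  toFun := hermiteSchwartz
  map_add' := hermiteSchwartz_add
  map_smul' := hermiteSchwartz_smul

/-- (Ported verbatim from the HodgeCMPerL package; no docstring in the source.) -/
@[simp] theorem hermiteSchwartzₗ_apply (p : MvPolynomial ι ℂ) : hermiteSchwartzₗ p = hermiteSchwartz p := rfl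

end Generic

/-! ## §2  The hyperbolic velocity and flow on `E6 = EuclideanSpace ℝ MixedVar` -/

/-- `ℝ³ × ℝ³` as a Euclidean space. -/
abbrev E6 : Type := EuclideanSpace ℝ MixedVar

/-- The coordinate identification `E6 ≃L (MixedVar → ℝ)`. -/
abbrev eE : E6 ≃L[ℝ] (MixedVar → ℝ) := EuclideanSpace.equiv MixedVar ℝ

/-- The velocity `(x, y) ↦ (−y, −x)` on `E6`. -/
def hypVelE : E6 →L[ℝ] E6 :=
  (eE.symm : (MixedVar → ℝ) →L[ℝ] E6).comp (hypVelCLM.comp (eE : E6 →L[ℝ] (MixedVar → ℝ)))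

/-- (Ported verbatim from the HodgeCMPerL package; no docstring in the source.) -/
theorem hypVelE_apply (x : E6) : hypVelE x = eE.symm (hypVel (eE x)) := rfl

/-- `J * J = 1` for `J = hypVelE` (the hypothesis of pv14-g6's `involFlow`). -/
theorem hypVelE_mul_self : hypVelE * hypVelE = 1 := by
  ext x : 1
  change hypVelE (hypVelE x) = x
  rw [hypVelE_apply, hypVelE_apply, ContinuousLinearEquiv.apply_symm_apply, hypVel_hypVel,
    ContinuousLinearEquiv.symm_apply_apply]

/-- The hyperbolic rotation on `E6`. -/
def hypRotE (s : ℝ) : E6 ≃L[ℝ] E6 := (eE.trans (hypRotEquiv s)).trans eE.symm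

/-- (Ported verbatim from the HodgeCMPerL package; no docstring in the source.) -/
theorem hypRotE_apply (s : ℝ) (x : E6) : hypRotE s x = eE.symm (hypRot s (eE x)) := rfl

/-- (Ported verbatim from the HodgeCMPerL package; no docstring in the source.) -/
theorem hypRotE_zero_apply (x : E6) : hypRotE 0 x = x := by
  rw [hypRotE_apply, hypRot_zero, ContinuousLinearEquiv.symm_apply_apply]

/-- (Ported verbatim from the HodgeCMPerL package; no docstring in the source.) -/
theorem hypRotE_add_apply (s t : ℝ) (x : E6) : hypRotE (s + t) x = hypRotE s (hypRotE t x) := by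
  rw [hypRotE_apply, hypRotE_apply, hypRotE_apply, ContinuousLinearEquiv.apply_symm_apply, hypRot_add_flow]

/-- `hypRotE s = cosh s • 1 + sinh s • hypVelE` (= pv14-g6's `coshSinhCLM hypVelE s`). -/
theorem hypRotE_eq_cosh_add_sinh (s : ℝ) :
    (hypRotE s : E6 →L[ℝ] E6) = Real.cosh s • (1 : E6 →L[ℝ] E6) + Real.sinh s • hypVelE := by
  ext x : 1
  change hypRotE s x = _
  rw [hypRotE_apply, hypRot_eq_cosh_add_sinh, map_add, map_smul, map_smul,
    ContinuousLinearEquiv.symm_apply_apply, add_apply, FunLike.coe_smul, FunLike.coe_smul, Pi.smul_apply,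
    Pi.smul_apply, one_apply_eq_self, hypVelE_apply]

/-! ## §3  The Schwartz-space form of the derivative -/

/-- **`D(hermiteSchwartz p)(x)(hypVelE x) = hermiteSchwartz (hypSymb p) x` (KERNEL)** — pv14-g6's
`flowGen hypVelE (hermiteSchwartz p)` is `hermiteSchwartz (hypSymb p)`, pointwise (`flowGen_apply` is `rfl`). -/
theorem fderiv_hermiteSchwartz_hypVelE (p : MvPolynomial MixedVar ℂ) (x : E6) :
    fderiv ℝ (⇑(hermiteSchwartz p)) x (hypVelE x) = hermiteSchwartz (hypSymb p) x := by
  rw [coe_hermiteSchwartz, hermiteSchwartz_apply', hypVelE_apply]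
  have hd : HasFDerivAt (fun y : E6 => hermiteFun p (eE y))
      ((fderiv ℝ (hermiteFun p) (eE x)).comp (eE : E6 →L[ℝ] (MixedVar → ℝ))) x :=
    ((differentiable_hermiteFun p) (eE x)).hasFDerivAt.comp x (eE : E6 ≃L[ℝ] (MixedVar → ℝ)).hasFDerivAt
  rw [hd.fderiv, ContinuousLinearMap.comp_apply, ContinuousLinearEquiv.coe_coe,
    ContinuousLinearEquiv.apply_symm_apply, fderiv_hermiteFun_hypVel]

/-- **Through the Bargmann dictionary**: on `hermiteSchwartz (binv F)`, `F ∈ ℂ[z_a, w_a]`, the generator of the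
hyperbolic flow is `binv ∘ printedHyp lamF` — pv12's printed Fock operator of `X₁` at Folland's scaling. -/
theorem fderiv_hermiteSchwartz_binv_hypVelE (F : MixedModel) (x : E6) :
    fderiv ℝ (⇑(hermiteSchwartz (binv F))) x (hypVelE x) = hermiteSchwartz (binv (printedHyp lamF F)) x := by
  rw [fderiv_hermiteSchwartz_hypVelE, binv_printedHyp]

end PrintDict
end Fock
end PerL34
end HodgeCM

end
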